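import Summits.Langlands.Statement

/-!
# `FifteenLocusEisenstein.SectorComplement` (item stmt-Langlands-16058) from its five leaves — STRUCTURAL glue
(crux-strategist planner-cstrat-stmt-Langlands-16058-r1-0, 2026-08-17; BC2 REDIRECT of the RESTATED deciding crux;
intended landing: `Summits/Langlands/Langlands/Theorems/FifteenLocusEisensteinSectorComplementSplit.lean`, `--workitem <glue item>`
or `--supports stmt-Langlands-16058`; imports `Summits.Langlands.Statement` ONLY — no Theses module (cycle rule) and no
Theorems module (cone-neutral: the route file's import cone is unchanged when the `_holds` link is rendered)).

The crux `SectorComplement := Target → _root_.Langlands` of route `FifteenLocusEisenstein` (Target = modularity, in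
point-count form, of every non-CM integral elliptic curve over every imaginary quadratic field) is the summit modulo its
antecedent (re-audit bin RESTATED, 2026-08-17).  This file proves, sorry-free, against TODAY's summit
(`Langlands := ∀ F, Nonempty (ReciprocityData F) ∧ ∀ 𝓡 n, 0 < n → ∀ hcpt, (A 𝓡) ∧ (B 𝓡)`, statement re-type p141787,
`∀ 𝓡`), the typed decomposition

  `N → W⁺ → B⁻ → LGC∀ → U → SectorComplement`          (`sectorComplement_of_leaves`)

with the five leaves stated VERBATIM as the texts of the route's children:
* N   `ReciprocityDataNonempty` — reciprocity data (Harris–Taylor `rec_v` at every completion, Henniart-normalised against the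
      pinned local Artin maps) exist for every number field: the summit's non-vacuity conjunct;
* W⁺  `SatakeAvatarExistence` (= item stmt-Langlands-17415 verbatim) — every L-algebraic cuspidal `π` of `GL_n(𝔸_K)` has an
      IRREDUCIBLE `ℓ`-adic avatar Satake–Frobenius compatible a.e. (Buzzard–Gee Conj. 3.2.2 weak form + Ramakrishnan);
* B⁻  `WeakAutomorphyOffTateFrames` — Fontaine–Mazur–Langlands in a.e. form OFF the Tate-frame sector (irreducible geometric
      `ρ` that are not a.e. Tate frames of a non-CM integral elliptic curve over an imaginary quadratic field, `n = 2`);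
* LGC∀ `SatakeAvatarCompatibility` — Taylor 2004 Conj. 7 for Satake pairs and EVERY reciprocity datum: an irreducible Satake
      avatar of `π` is de Rham above `ℓ` (Fontaine's pinned datum) and locally–globally compatible with `π` at every finite place;
* U   `AvatarConjugacy` (= item stmt-Langlands-17844 verbatim) — the irreducible Satake avatar is unique up to conjugacy.

MATHEMATICAL CONTENT OF THE SEAM (why it is not `exact ⟨h₁, h₂⟩`): the route's TARGET is consumed.  Direction (B) for a given
`𝓡`: an irreducible geometric `ρ` either lies in the Tate-frame sector — then `K` is imaginary quadratic, `n = 2`, and the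
Target's cuspidal `π` with `Σ α_w⁻¹ = a_w(E)`, `Π α_w⁻¹ = N w` is Satake–Frobenius compatible with `ρ` a.e. by VIETA for the
2-entry Satake parameter (`arithFrobPolyOfSatake ι (N w) 1 α_w = X² - a_w X + N w`, `ι⁻¹` fixing `ℤ`; lemma
`arithFrobPolyOfSatake_one_of_card_two`) — or it does not, and B⁻ applies; then LGC∀ at `𝓡`.  Direction (A): W⁺ gives the
irreducible avatar, LGC∀ makes it geometric (`𝓡.pst` IS Fontaine's datum, `rfl`) and compatible at `𝓡`, U is the uniqueness
clause.  `Nonempty (ReciprocityData F)` is N.  No Jacquet–Shalika input and no Chebotarev import are needed (irreducibility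
and uniqueness are the leaves W⁺ and U), so the file is cone-neutral.

No definitions; axioms `propext`, `Classical.choice`, `Quot.sound`.

References: K. Buzzard, T. Gee, LMS LNS 414 (2014), Conj. 3.2.1–3.2.2 [BuzzardGeeLMS2014]; J.-M. Fontaine, B. Mazur
(1995), Conj. 1 [FontaineMazurGeometric1995]; R. Taylor, Ann. Fac. Sci. Toulouse 13 (2004), Conj. 7 [TaylorGaloisRepresentations2004];
M. Harris, R. Taylor, Ann. Math. Stud. 151 (2001), Thm. A [HarrisTaylorAMS2001]; P. Deligne, J.-P. Serre, ASENS 7 (1974),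
Lemme 3.2 [DeligneSerreASENS1974]; A. Caraiani, J. Newton, arXiv:2301.10509, Thm. 1.1 [CaraianiNewton2023].
-/

noncomputable section

set_option linter.dupNamespace false -- project-wide option; `Summit.Langlands.Langlands` is the mandated namespace

open scoped NumberField Classical Polynomial
open Filter IsDedekindDomain Polynomial
open Literature.NumberTheory.Automorphic Literature.NumberTheory.GaloisRepresentations
open Summit.Langlands

namespace Summit.Langlands.Langlands.Theorems.FifteenLocusEisensteinSectorComplementSplit

/-- Vieta for a Satake parameter of `GL₂` read through point counts: if `card α = 2`, `Σ α⁻¹ = a` and `Π α⁻¹ = q`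
then `∏_{x ∈ α} (X - ι⁻¹(x⁻¹)) = X² - a X + q` over `ℚ̄_ℓ` (`ι⁻¹` fixes the integer `a` and the natural number `q`).
[folklore] -/
theorem arithFrobPolyOfSatake_one_of_card_two {ℓ : ℕ} [Fact ℓ.Prime] (ι : PadicAlgCl ℓ ≃+* ℂ) (q : ℕ)
    {α : Multiset ℂ} (hcard : Multiset.card α = 2) {a : ℤ}
    (hsum : (α.map fun x => x⁻¹).sum = (a : ℂ)) (hprod : (α.map fun x => x⁻¹).prod = (q : ℂ)) :
    arithFrobPolyOfSatake ι q 1 α =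
      Polynomial.X ^ 2 - Polynomial.C ((a : ℤ) : PadicAlgCl ℓ) * Polynomial.X + Polynomial.C ((q : ℕ) : PadicAlgCl ℓ) := by
  obtain ⟨x, y, rfl⟩ := Multiset.card_eq_two.mp hcard
  rw [arithFrobPolyOfSatake_one]
  simp only [Multiset.insert_eq_cons, Multiset.map_cons, Multiset.map_singleton, Multiset.sum_cons,
    Multiset.sum_singleton, Multiset.prod_cons, Multiset.prod_singleton] at hsum hprod ⊢
  have h1 : ι.symm x⁻¹ + ι.symm y⁻¹ = (a : PadicAlgCl ℓ) := by
    rw [← map_add, hsum, map_intCast]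
  have h2 : ι.symm x⁻¹ * ι.symm y⁻¹ = (q : PadicAlgCl ℓ) := by
    rw [← map_mul, hprod, map_natCast]
  rw [← h1, ← h2, Polynomial.C_add, Polynomial.C_mul]
  ring

/-- **`SectorComplement` from its five leaves N, W⁺, B⁻, LGC∀, U** (texts verbatim; the conclusion is the text of
`FifteenLocusEisenstein.SectorComplement`, whose antecedent — the route's Target — is USED: it discharges the Tate-frame
sector of direction (B)).  See the module docstring for the seam.
[cite: BuzzardGeeLMS2014, Conj. 3.2.1 and Conj. 3.2.2] [cite: FontaineMazurGeometric1995, Conj. 1]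
[cite: TaylorGaloisRepresentations2004, Conj. 7] [cite: DeligneSerreASENS1974, Lemme 3.2] -/
theorem sectorComplement_of_leaves :
    (∀ (K : Type) [Field K] [NumberField K], Nonempty (ReciprocityData K)) →
    (∀ (K : Type) [Field K] [NumberField K] (n : ℕ) (hcpt : Literature.NumberTheory.Automorphic.isCompact_glFiniteIntegralLevel n K), 0 < n → ∀ (π : Literature.NumberTheory.Automorphic.CuspidalAutomorphicRepData n K hcpt), π.1.IsLAlgebraic → ∀ (ℓ : ℕ) [Fact ℓ.Prime] (ι : PadicAlgCl ℓ ≃+* ℂ), ∃ ρ : Literature.NumberTheory.GaloisRepresentations.FramedGaloisRep K (PadicAlgCl ℓ) n, ρ.toGaloisRep.IsIrreducible ∧ ∀ᶠ v : IsDedekindDomain.HeightOneSpectrum (NumberField.RingOfIntegers K) in cofinite, SatakeFrobCompatibleAt ι π.1 ρ v) →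
    (∀ (K : Type) [Field K] [NumberField K] (n : ℕ) (hcpt : Literature.NumberTheory.Automorphic.isCompact_glFiniteIntegralLevel n K), 0 < n → ∀ (ℓ : ℕ) [Fact ℓ.Prime] (ι : PadicAlgCl ℓ ≃+* ℂ) (ρ : Literature.NumberTheory.GaloisRepresentations.FramedGaloisRep K (PadicAlgCl ℓ) n), ρ.toGaloisRep.IsIrreducible → ((∀ᶠ v : IsDedekindDomain.HeightOneSpectrum (NumberField.RingOfIntegers K) in cofinite, ρ.IsUnramifiedAt v) ∧ ∀ (v : IsDedekindDomain.HeightOneSpectrum (NumberField.RingOfIntegers K)) (hv : ((ℓ : ℕ) : NumberField.RingOfIntegers K) ∈ v.asIdeal), (Literature.NumberTheory.PAdicHodge.fontainePstAdicCompletion v ℓ hv).IsDeRhamFramed (ρ.toLocal v)) → ¬ (NumberField.IsTotallyComplex K ∧ Module.finrank ℚ K = 2 ∧ n = 2 ∧ ∃ E : WeierstrassCurve (NumberField.RingOfIntegers K), E.Δ ≠ 0 ∧ ¬ (E.baseChange K).HasCM ∧ ∀ᶠ w : IsDedekindDomain.HeightOneSpectrum (NumberField.RingOfIntegers K) in cofinite,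 ρ.IsUnramifiedAt w ∧ ρ.HasFrobCharpolyAt w (Polynomial.X ^ 2 - Polynomial.C ((Literature.NumberTheory.Automorphic.frobTraceAt E w : ℤ) : PadicAlgCl ℓ) * Polynomial.X + Polynomial.C ((w.residueCard : ℕ) : PadicAlgCl ℓ))) → ∃ π : Literature.NumberTheory.Automorphic.CuspidalAutomorphicRepData n K hcpt, π.1.IsLAlgebraic ∧ ∀ᶠ v : IsDedekindDomain.HeightOneSpectrum (NumberField.RingOfIntegers K) in cofinite, SatakeFrobCompatibleAt ι π.1 ρ v) →
    (∀ (K : Type) [Field K] [NumberField K] (n : ℕ) (hcpt : Literature.NumberTheory.Automorphic.isCompact_glFiniteIntegralLevel n K), 0 < n → ∀ (π : Literature.NumberTheory.Automorphic.CuspidalAutomorphicRepData n K hcpt), π.1.IsLAlgebraic → ∀ (ℓ : ℕ) [Fact ℓ.Prime] (ι : PadicAlgCl ℓ ≃+* ℂ) (ρ : Literature.NumberTheory.GaloisRepresentations.FramedGaloisRep K (PadicAlgCl ℓ) n), ρ.toGaloisRep.IsIrreducible → (∀ᶠ v : IsDedekindDomain.HeightOneSpectrum (NumberField.RingOfIntegers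 K) in Filter.cofinite, SatakeFrobCompatibleAt ι π.1 ρ v) → (∀ (v : IsDedekindDomain.HeightOneSpectrum (NumberField.RingOfIntegers K)) (hv : ((ℓ : ℕ) : NumberField.RingOfIntegers K) ∈ v.asIdeal), (Literature.NumberTheory.PAdicHodge.fontainePstAdicCompletion v ℓ hv).IsDeRhamFramed (ρ.toLocal v)) ∧ ∀ (𝓡 : ReciprocityData K) (v : IsDedekindDomain.HeightOneSpectrum (NumberField.RingOfIntegers K)), LocalGlobalCompatibleAt 𝓡 ι π.1 ρ v) →
    (∀ (K : Type) [Field K] [NumberField K] (n : ℕ) (hcpt : Literature.NumberTheory.Automorphic.isCompact_glFiniteIntegralLevel n K) (π : Literature.NumberTheory.Automorphic.CuspidalAutomorphicRepData n K hcpt) (ℓ : ℕ) [Fact ℓ.Prime] (ι : PadicAlgCl ℓ ≃+* ℂ) (ρ₀ ρ : Literature.NumberTheory.GaloisRepresentations.FramedGaloisRep K (PadicAlgCl ℓ) n), ρ₀.toGaloisRep.IsIrreducible → (∀ᶠ v : IsDedekindDomain.HeightOneSpectrum (NumberField.RingOfIntegers K) in Filter.cofinite, Summit.Langlands.SatakeFrobCompatibleAt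 ι π.1 ρ₀ v) → (∀ᶠ v : IsDedekindDomain.HeightOneSpectrum (NumberField.RingOfIntegers K) in Filter.cofinite, Summit.Langlands.SatakeFrobCompatibleAt ι π.1 ρ v) → Summit.Langlands.IsConjugate ρ₀ ρ) →
    ((∀ (F : Type) [Field F] [NumberField F], NumberField.IsTotallyComplex F → Module.finrank ℚ F = 2 → ∀ (E : WeierstrassCurve (NumberField.RingOfIntegers F)), E.Δ ≠ 0 → ¬ (E.baseChange F).HasCM → ∀ (hcpt : Literature.NumberTheory.Automorphic.isCompact_glFiniteIntegralLevel 2 F), ∃ π : Literature.NumberTheory.Automorphic.CuspidalAutomorphicRepData 2 F hcpt, π.1.IsLAlgebraic ∧ ∀ᶠ w : IsDedekindDomain.HeightOneSpectrum (NumberField.RingOfIntegers F) in Filter.cofinite, ∃ α : Multiset ℂ, π.1.HasSatakeParamAt w α ∧ (α.map fun a => a⁻¹).sum = (Literature.NumberTheory.Automorphic.frobTraceAt E w : ℂ) ∧ (α.map fun a => a⁻¹).prod = (w.residueCard : ℂ)) → _root_.Langlands) := by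
  intro hN hW hB hL hU hT F _ _
  refine ⟨hN F, fun 𝓡 n hn hcpt => ⟨?_, ?_⟩⟩
  · -- (A) automorphic → Galois
    intro π hπ ℓ _ ι
    obtain ⟨ρ, hirr, hρ⟩ := hW F n hcpt hn π hπ ℓ ι
    obtain ⟨hdR, hloc⟩ := hL F n hcpt hn π hπ ℓ ι ρ hirr hρ
    have hgeo : IsGeometricFramed 𝓡 ρ :=
      ⟨hρ.mono fun v ⟨_, _, hur, _⟩ => hur, fun v hv => hdR v hv⟩
    exact ⟨ρ, hirr, hgeo, ⟨hρ, hloc 𝓡⟩, fun ρ' h' => hU F n hcpt π ℓ ι ρ ρ' hirr hρ h'.1⟩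
  · -- (B) Galois → automorphic
    intro ℓ _ ι ρ hirr hgeo
    have hex : ∃ π : CuspidalAutomorphicRepData n F hcpt, π.1.IsLAlgebraic ∧
        ∀ᶠ v : HeightOneSpectrum (𝓞 F) in cofinite, SatakeFrobCompatibleAt ι π.1 ρ v := by
      by_cases hsec : (NumberField.IsTotallyComplex F ∧ Module.finrank ℚ F = 2 ∧ n = 2 ∧
          ∃ E : WeierstrassCurve (𝓞 F), E.Δ ≠ 0 ∧ ¬ (E.baseChange F).HasCM ∧
            ∀ᶠ w : HeightOneSpectrum (𝓞 F) in cofinite, ρ.IsUnramifiedAt w ∧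
              ρ.HasFrobCharpolyAt w (Polynomial.X ^ 2 -
                Polynomial.C ((frobTraceAt E w : ℤ) : PadicAlgCl ℓ) * Polynomial.X +
                  Polynomial.C ((w.residueCard : ℕ) : PadicAlgCl ℓ)))
      · -- on the Tate-frame sector: the route's TARGET, read through Vieta
        obtain ⟨htc, hdeg, hn2, E, hΔ, hcm, hframe⟩ := hsec
        subst hn2
        obtain ⟨π, hLalg, hsat⟩ := hT F htc hdeg E hΔ hcm hcpt
        refine ⟨π, hLalg, ?_⟩
        filter_upwards [hsat, hframe] with w hw hw'
        obtain ⟨α, hα, hs, hp⟩ := hw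
        obtain ⟨hur, hcp⟩ := hw'
        refine ⟨α, hα, hur, ?_⟩
        rw [arithFrobPolyOfSatake_one_of_card_two ι w.residueCard hα.card_eq hs hp]
        exact hcp
      · -- off the sector: B⁻
        exact hB F n hcpt hn ℓ ι ρ hirr hgeo hsec
    obtain ⟨π, hLalg, hsat⟩ := hex
    obtain ⟨-, hloc⟩ := hL F n hcpt hn π hLalg ℓ ι ρ hirr hsat
    exact ⟨π, hLalg, hsat, hloc 𝓡⟩

end Summit.Langlands.Langlands.Theorems.FifteenLocusEisensteinSectorComplementSplit

end
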